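import Summits.CriticalPhenomena.PercolationContinuityZ3.Theorems.PercNearOneGluingNoHeavyLowerTailTIncBernsteinPieces
import Summits.CriticalPhenomena.PercolationContinuityZ3.Theorems.PercNearOneGluingNoHeavyLowerTailThreePointGammaForced
import Mathlib.Tactic.Linarith
import Mathlib.Tactic.LinearCombination
import HarnessLib


/-!
# `NoHeavyLowerTail` (stmt-CriticalPhenomena-4575) — (TB1),(TB2) by fibrewise positivity, IV-a: the forcing dictionary
# (`PrW_forced`: forced pairs = weight-one pairs), `T_inc ≥ 0` for forced laws, and the de Casteljau identities of the pieces

Support file (prover prim-l12-p6 gen 3; `--supports stmt-CriticalPhenomena-4575`).  No definitions, no named facts, no sorries.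
* `PrW_erase_of_insensitive`, **`PrW_forced`**: `PrW D p {S | ψ (S ∪ K)} = PrW (D ∪ K) (fun i => if i ∈ K then 1 else p i) {S | ψ S}` —
  prove-2's forced-edge laws (`CubicThreePointStep.R K S`, cells `evQ/evU₁/evU₂/evU₃/evT K`) are plain weighted laws on `D ∪ K`
  (induction on `K`, one pair at a time by `ThreePointGamma.PrW_insert_forced`); `forcedWeights_nonneg/le_one`; `R_forced_iff`, `R_forced_insert_iff`.
* `tincW_nonneg` — `0 ≤ tincW D p K a b c` for ALL `D, K, p ∈ [0,1]`: prim-e3grp-switch-1's `TIncSwitching.tInc_PrW` through the dictionary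
  (`ThreePointGamma.evQ_empty` …, `TIncFibre.push_univ` for the normalisation).
* `threeTB₁_deCasteljau`, `threeTB₂_deCasteljau`, `threeTB₁_zero`, `threeTB₂_zero` (`ring`): the pieces of the sub-pencil `[(1−s)c⁰+sc¹, c¹]`
  are `(1−s)²·threeTB₁ + 2s(1−s)·threeTB₂ + 3s²·T(c¹)` resp. `(1−s)·threeTB₂ + 3s·T(c¹)`; without transitions both pieces are `3·T(c⁰)`.
Used by `…TIncBernsteinStepHyp` (`stepHypT_holds : StepHypT V`).  [this work]
-/

noncomputable section

namespace Summit.CriticalPhenomena.PercolationContinuityZ3.Theorems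

namespace TIncFibre

open Finset Literature.Probability.Percolation Literature.Probability.Percolation.DecisionTree
open Literature.Probability.Percolation.Gladkov ThreePointLB TIncSwitching CubicThreePointStep ThreePointGamma
open Literature.Probability.Percolation.DecisionTree.DTree2 (ins wt1 mem_ins_self_iff)
open scoped Classical

variable {V : Type*} [Fintype V] [DecidableEq V]

/-! ### Forcing a set of pairs = giving them weight one -/

section Forcing

omit [Fintype V] in
/-- A coordinate the event does not see can be erased from the random set. [folklore] -/
theorem PrW_erase_of_insensitive (D : Finset (Sym2 V)) (p : Sym2 V → ℝ) {k : Sym2 V} (hk : k ∈ D)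
    {X : Set (Finset (Sym2 V))} (hX : ∀ S, insert k S ∈ X ↔ S ∈ X) : PrW D p X = PrW (D.erase k) p X := by
  have hset : {S : Finset (Sym2 V) | insert k S ∈ X} = X := by ext S; exact hX S
  conv_lhs => rw [(Finset.insert_erase hk).symm]
  rw [CubicThreePointStep.PrW_split (D.erase k) p (Finset.notMem_erase k D) X, hset]
  ring

omit [Fintype V] in
/-- **Forcing = weight one.**  For every forced set `K`: `PrW D p {S | ψ (S ∪ K)} = PrW (D ∪ K) p_K {S | ψ S}` with `p_K = 1` on `K`, `= p` off `K`.
[folklore] -/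
theorem PrW_forced (K : Finset (Sym2 V)) :
    ∀ (D : Finset (Sym2 V)) (p : Sym2 V → ℝ) (ψ : Finset (Sym2 V) → Prop),
      PrW D p {S | ψ (S ∪ K)} = PrW (D ∪ K) (fun i => if i ∈ K then 1 else p i) {S | ψ S} := by
  induction K using Finset.induction_on with
  | empty =>
    intro D p ψ
    have hp : (fun i => if i ∈ (∅ : Finset (Sym2 V)) then (1 : ℝ) else p i) = p := funext fun i => by simp
    simp only [Finset.union_empty, hp]
  | insert k K' hk ih =>
    intro D p ψ
    have hset : {S : Finset (Sym2 V) | ψ (S ∪ insert k K')} = {S | insert k S ∈ {T : Finset (Sym2 V) | ψ (T ∪ K')}} := by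
      ext S; simp only [Set.mem_setOf_eq, Finset.union_insert, Finset.insert_union]
    have hfun : (fun i => if i ∈ K' then (1 : ℝ) else Function.update p k 1 i) = (fun i => if i ∈ insert k K' then 1 else p i) := by
      funext i
      by_cases hi : i = k
      · subst hi; simp [hk]
      · simp [Finset.mem_insert, hi]
    rw [hset]
    by_cases hkD : k ∈ D
    · have hins : ∀ S : Finset (Sym2 V),
          insert k S ∈ {S : Finset (Sym2 V) | insert k S ∈ {T : Finset (Sym2 V) | ψ (T ∪ K')}} ↔
            S ∈ {S : Finset (Sym2 V) | insert k S ∈ {T : Finset (Sym2 V) | ψ (T ∪ K')}} := by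
        intro S; simp only [Set.mem_setOf_eq, Finset.insert_idem]
      rw [PrW_erase_of_insensitive D p hkD hins, ← PrW_insert_forced (D.erase k) p (Finset.notMem_erase k D), ih, hfun,
        Finset.insert_erase hkD]
      have hD : D ∪ K' = D ∪ insert k K' := by
        ext i
        simp only [Finset.mem_union, Finset.mem_insert]
        constructor
        · intro h
          rcases h with h | h
          · exact Or.inl h
          · exact Or.inr (Or.inr h)
        · intro h
          rcases h with h | h | h
          · exact Or.inl h
          · exact Or.inl (h ▸ hkD)
          · exact Or.inr h
      rw [hD]
    · rw [← PrW_insert_forced D p hkD, ih, hfun]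
      have hD : insert k D ∪ K' = D ∪ insert k K' := by
        ext i; simp only [Finset.mem_union, Finset.mem_insert]; tauto
      rw [hD]

omit [Fintype V] in
/-- The forced weights lie in `[0,1]`. [folklore] -/
theorem forcedWeights_nonneg {p : Sym2 V → ℝ} (hp0 : ∀ i, 0 ≤ p i) (K : Finset (Sym2 V)) (i : Sym2 V) :
    0 ≤ (fun i => if i ∈ K then (1 : ℝ) else p i) i := by
  by_cases hi : i ∈ K <;> simp [hi, hp0 i]

omit [Fintype V] in
/-- The forced weights lie in `[0,1]`. [folklore] -/
theorem forcedWeights_le_one {p : Sym2 V → ℝ} (hp1 : ∀ i, p i ≤ 1) (K : Finset (Sym2 V)) (i : Sym2 V) :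
    (fun i => if i ∈ K then (1 : ℝ) else p i) i ≤ 1 := by
  by_cases hi : i ∈ K <;> simp [hi, hp1 i]

omit [Fintype V] in
/-- `R K S = R ∅ (S ∪ K)`. [folklore] -/
theorem R_forced_iff (K S : Finset (Sym2 V)) (x y : V) :
    CubicThreePointStep.R K S x y ↔ CubicThreePointStep.R ∅ (S ∪ K) x y := by
  unfold CubicThreePointStep.R; rw [Finset.union_empty]

omit [Fintype V] in
/-- `R (K ∪ {e}) S = R ∅ ((S ∪ K) ∪ {e})`. [folklore] -/
theorem R_forced_insert_iff (K S : Finset (Sym2 V)) (e : Sym2 V) (x y : V) :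
    CubicThreePointStep.R (insert e K) S x y ↔ CubicThreePointStep.R ∅ (insert e (S ∪ K)) x y := by
  unfold CubicThreePointStep.R; rw [Finset.union_empty, Finset.union_insert]

end Forcing

/-! ### `T_inc ≥ 0` for forced laws, and the algebra of the degenerate cases -/

section Algebra

variable {R : Type*} [CommRing R]

/-- de Casteljau for the first piece: the sub-pencil `[(1−s)c⁰ + s c¹, c¹]`. [folklore] -/
theorem threeTB₁_deCasteljau (q u₁ u₂ u₃ t α₁ α₂ β₁ β₂ β₃ s : R) :
    threeTB₁ (q + s * (-α₁ - α₂)) (u₁ + s * (α₁ - β₁)) (u₂ + s * (α₂ - β₂)) (u₃ + s * (-β₃)) (t + s * (β₁ + β₂ + β₃))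
        ((1 - s) * α₁) ((1 - s) * α₂) ((1 - s) * β₁) ((1 - s) * β₂) ((1 - s) * β₃) =
      (1 - s) ^ 2 * threeTB₁ q u₁ u₂ u₃ t α₁ α₂ β₁ β₂ β₃ + 2 * s * (1 - s) * threeTB₂ q u₁ u₂ u₃ t α₁ α₂ β₁ β₂ β₃ +
        3 * s ^ 2 * Tinc (q - α₁ - α₂) (u₁ + α₁ - β₁) (u₂ + α₂ - β₂) (u₃ - β₃) (t + β₁ + β₂ + β₃) := by
  simp only [threeTB₁, threeTB₂, Tinc]; ring

/-- de Casteljau for the second piece. [folklore] -/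
theorem threeTB₂_deCasteljau (q u₁ u₂ u₃ t α₁ α₂ β₁ β₂ β₃ s : R) :
    threeTB₂ (q + s * (-α₁ - α₂)) (u₁ + s * (α₁ - β₁)) (u₂ + s * (α₂ - β₂)) (u₃ + s * (-β₃)) (t + s * (β₁ + β₂ + β₃))
        ((1 - s) * α₁) ((1 - s) * α₂) ((1 - s) * β₁) ((1 - s) * β₂) ((1 - s) * β₃) =
      (1 - s) * threeTB₂ q u₁ u₂ u₃ t α₁ α₂ β₁ β₂ β₃ +
        3 * s * Tinc (q - α₁ - α₂) (u₁ + α₁ - β₁) (u₂ + α₂ - β₂) (u₃ - β₃) (t + β₁ + β₂ + β₃) := by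
  simp only [threeTB₂, Tinc]; ring

/-- No transitions: `threeTB₁(c, 0) = 3·T(c)`. [folklore] -/
theorem threeTB₁_zero (q u₁ u₂ u₃ t : R) : threeTB₁ q u₁ u₂ u₃ t 0 0 0 0 0 = 3 * Tinc q u₁ u₂ u₃ t := by
  simp only [threeTB₁, Tinc]; ring

/-- No transitions: `threeTB₂(c, 0) = 3·T(c)`. [folklore] -/
theorem threeTB₂_zero (q u₁ u₂ u₃ t : R) : threeTB₂ q u₁ u₂ u₃ t 0 0 0 0 0 = 3 * Tinc q u₁ u₂ u₃ t := by
  simp only [threeTB₂, Tinc]; ring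

end Algebra

section Forced

variable {p : Sym2 V → ℝ} (hp0 : ∀ i, 0 ≤ p i) (hp1 : ∀ i, p i ≤ 1)
include hp0 hp1

/-- **`T_inc ≥ 0` for every law with forced edges**: `0 ≤ tincW D p K a b c` (prim-e3grp-switch-1's theorem `tInc_PrW` moved to the forced
vocabulary by `PrW_forced`). [this work] -/
theorem tincW_nonneg (D K : Finset (Sym2 V)) (a b c : V) : 0 ≤ tincW D p K a b c := by
  set pK : Sym2 V → ℝ := fun i => if i ∈ K then 1 else p i with hpK
  have hK0 : ∀ i, 0 ≤ pK i := forcedWeights_nonneg hp0 K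
  have hK1 : ∀ i, pK i ≤ 1 := forcedWeights_le_one hp1 K
  have hQ : PrW D p (evQ K a b c) = PrW (D ∪ K) pK ((conn a b)ᶜ ∩ ((conn a c)ᶜ ∩ (conn b c)ᶜ)) := by
    rw [← evQ_empty, show evQ K a b c = {S | (S ∪ K) ∈ evQ (∅ : Finset (Sym2 V)) a b c} from by
      ext S; simp only [Set.mem_setOf_eq, mem_evQ, CubicThreePointStep.R, Finset.union_empty]]
    exact PrW_forced K D p _
  have hT : PrW D p (evT K a b c) = PrW (D ∪ K) pK (conn a b ∩ conn a c) := by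
    rw [← evT_empty, show evT K a b c = {S | (S ∪ K) ∈ evT (∅ : Finset (Sym2 V)) a b c} from by
      ext S; simp only [Set.mem_setOf_eq, mem_evT, CubicThreePointStep.R, Finset.union_empty]]
    exact PrW_forced K D p _
  have h1 : PrW D p (evU₁ K a b c) = PrW (D ∪ K) pK (conn a b ∩ (conn a c)ᶜ) := by
    rw [← evU₁_empty, show evU₁ K a b c = {S | (S ∪ K) ∈ evU₁ (∅ : Finset (Sym2 V)) a b c} from by
      ext S; simp only [Set.mem_setOf_eq, mem_evU₁, CubicThreePointStep.R, Finset.union_empty]]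
    exact PrW_forced K D p _
  have h2 : PrW D p (evU₂ K a b c) = PrW (D ∪ K) pK (conn a c ∩ (conn a b)ᶜ) := by
    rw [← evU₂_empty, show evU₂ K a b c = {S | (S ∪ K) ∈ evU₂ (∅ : Finset (Sym2 V)) a b c} from by
      ext S; simp only [Set.mem_setOf_eq, mem_evU₂, CubicThreePointStep.R, Finset.union_empty]]
    exact PrW_forced K D p _
  have h3 : PrW D p (evU₃ K a b c) = PrW (D ∪ K) pK (conn b c ∩ (conn a b)ᶜ) := by
    rw [← evU₃_empty, show evU₃ K a b c = {S | (S ∪ K) ∈ evU₃ (∅ : Finset (Sym2 V)) a b c} from by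
      ext S; simp only [Set.mem_setOf_eq, mem_evU₃, CubicThreePointStep.R, Finset.union_empty]]
    exact PrW_forced K D p _
  have hsum := push_univ pK (D ∪ K) (fun S => S) a b c
  simp only [Set.setOf_mem_eq, PrW_univ] at hsum
  have key := tInc_PrW hK0 hK1 (D ∪ K) a b c
  unfold tincW
  rw [hQ, hT, h1, h2, h3]
  set q := PrW (D ∪ K) pK ((conn a b)ᶜ ∩ ((conn a c)ᶜ ∩ (conn b c)ᶜ))
  set t := PrW (D ∪ K) pK (conn a b ∩ conn a c)
  set uc := PrW (D ∪ K) pK (conn a b ∩ (conn a c)ᶜ)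
  set ub := PrW (D ∪ K) pK (conn a c ∩ (conn a b)ᶜ)
  set ua := PrW (D ∪ K) pK (conn b c ∩ (conn a b)ᶜ)
  have hTinc : Tinc q uc ub ua t = (1 + q) * (q * t - (uc * ub + uc * ua + ub * ua)) - uc * ub * ua := by
    simp only [Tinc]
    linear_combination (q * t - (uc * ub + uc * ua + ub * ua)) * hsum.symm
  rw [hTinc]
  exact key

end Forced


end TIncFibre

end Summit.CriticalPhenomena.PercolationContinuityZ3.Theorems

end
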